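import Summits.HodgeConjecture.HodgeConjecture.Theorems.Ring2AbelianAllAndreFibreClassPointwise
import HarnessLib

/-!
# Ring 2 · sub-cell AbelianAll (ALL ABELIAN VARIETIES), André axis, part X-d — the fibre-class Lefschetz
# nodes need the Hodge conjecture for `𝒳 × 𝒳` in ONE codimension only (the relative dimension `d`), and
# the relative-dimension-1 rung (compact pencils of elliptic curves) is a THEOREM modulo Deligne's kernel
# identity (Lefschetz `(1,1)` on the fourfold `𝒳 × 𝒳`)

HONEST FRAMING (page 1, verbatim): **research route, not a corollary; conditional on HC_CM plus one named
minimal statement.** Cell line: research route conditional on HC_CM; not a corollary; Q11.4-sentence-2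
already refuted in dim ≥ 3. Nothing in this file proves a case of the Hodge conjecture. `HC_CM` =
`Theses.RankFourFaces.CMAbelianHodge` (a BINDER), `HC_AV` = `Theses.PadicSemiregularLift.HodgeAbelianVarieties`,
item `Theses.RankFourFaces.CMToAbelian` (stmt-16267) OPEN and not closed here. Seat `pub-hodge-ring2-ab-andre-2`,
gen 3; sequel of parts X-a/X-b/X-c (brief (ii): "replace `B` by algebraicity of specific Künneth/Lefschetz
components and re-prove — record each version"; (iii): "smallest open instance stated as a find-the-cycle
problem; partial results as theorems").

## Content (everything PROVED; no definition, no new node, no named fact)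

* §1 `isAlgebraicCorrespondence_of_hodgeClasses_algebraic_prod` — the per-codimension form of lit's
  `isAlgebraicCorrespondence_of_hodgeConjectureFor_prod` (Voisin I Lemma 11.41 in every bidegree): a rational
  bidegree-`(e − n, e − n)` map `φ : Hᵃ(X) → Hᵇ(Y)` is an algebraic correspondence as soon as the rational
  `(e, e)`-classes of `Y × X` are algebraic — ONLY codimension `e` of `HC(Y × X)` is used (the proof of the lit
  lemma verbatim with `hHC.2 e` replaced by the hypothesis).
* §2 For a compact pencil `f : 𝒳 ⟶ S` of abelian `d`-folds the quasi-inverse of `L_t = j_{t*} j_t^*` on `H²ᵖ(𝒳)`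
  is a class of codimension `e = d` on the `(2d+2)`-fold `𝒳 × 𝒳` — FOR EVERY `p`. Hence, with
  `HC^{d}(𝒳 × 𝒳)` := "rational `(d, d)`-classes on `𝒳 × 𝒳` are algebraic":
  `exists_algebraic_quasiInverse_fiberGysin_of_codim` (each `t`, no binder),
  `fibreClassLefschetzPointwiseOn_of_codim : κ_f → HC^{d}(𝒳 × 𝒳) → (β′ᵖᵗ_f)`,
  `algebraicFibreClassQuasiInverseOn_of_codim : φ_f → HC^{d}(𝒳 × 𝒳) → (A_f)`,
  `fibreClassLefschetzOn_of_codim : κ_f → φ_f → HC^{d}(𝒳 × 𝒳) → (β′_f)`, and the graded universal form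
  `fibreClassLefschetzOnAtRelDim_of_codim d`. For the W₆ habitat (`d = 6`, `𝒳⁷ → C`): only the codimension-6
  Hodge classes of the 14-fold `𝒳 × 𝒳` matter.
* §3 **`d = 1`: for every compact pencil of elliptic curves the pointwise fibre-class Lefschetz node holds modulo
  κ_f ALONE** (`fibreClassLefschetzPointwiseOn_of_relDim_one`) — `HC¹` of the fourfold `𝒳 × 𝒳` is the Lefschetz
  theorem on `(1,1)`-classes (`lefschetzOneOne_rational_holds`); and (β′_f) modulo κ_f, φ_f
  (`fibreClassLefschetzOn_of_relDim_one`). So the Lefschetz-type ladder (β′ᵖᵗ)_d has its `d ≤ 1` rungs closed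
  modulo print-true topology, like the (5∀)_d ladder (`d ≤ 1` theorems, andre-1 VII / lit p201770); first rung
  needing cycles: `d = 2` (codimension-2 classes on the sixfold `𝒳 × 𝒳` of an abelian-surface pencil).

References: VoisinHodgeI2002 (§11.3.3 Lemma 11.41, Thm. 11.30); Voisin2025 (Lemma 2.9, §3.2.2 (15)–(16),
Conj. 3.11, Prop. 2.11); Abdulali1994FamiliesAV (Conj. 5.3, Rem. 5.4); Andre1996Motifs (Remarque 2);
DeligneHodgeII1971 (Thm. 4.1.1, 4.2.6); Kleiman1968AlgebraicCycles (§2).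
-/

noncomputable section

set_option linter.dupNamespace false

namespace Summit.HodgeConjecture.HodgeConjecture.Ring2.AbelianAll

open CategoryTheory AlgebraicGeometry MonoidalCategory
open Literature.AlgebraicGeometry Literature.AlgebraicGeometry.Motives
open Literature.AlgebraicGeometry.HodgeTheory
open Literature.AlgebraicGeometry.Deligne1982 (cmLocus)
open Summit.HodgeConjecture.HodgeConjecture
open Summit.HodgeConjecture.HodgeConjecture.Theses

/-! ## §1 Voisin's Lemma 11.41 bridge, per codimension -/

section Bridge

variable {m n : ℕ} {Y X : SchemeOver ℂ}

/-- **A rational morphism of Hodge structures `Hᵃ(X) → Hᵇ(Y)` of bidegree `(e − n, e − n)` is an algebraic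
correspondence as soon as the rational `(e, e)`-classes of `Y × X` are algebraic** — the per-codimension form
of the tree's `isAlgebraicCorrespondence_of_hodgeConjectureFor_prod` (same proof: Voisin I Lemma 11.41 in every
bidegree, `exists_hodgeClass_corrAction_eq_smul_of_shift`, gives `φ = (t⁻¹ • γ)_*` for a rational `(e,e)`-class
`γ`, algebraic by hypothesis). [cite: VoisinHodgeI2002, §11.3.3 Lemma 11.41] [cite: Voisin2025, Lemma 2.9 and §3.2.2 (15)–(16)]
[cite: Andre1996Motifs, §2.1 remark following Déf. 1 (p. 14)] -/
theorem isAlgebraicCorrespondence_of_hodgeClasses_algebraic_prod (hY : IsSmoothProjective m Y)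
    (hX : IsSmoothProjective n X) {a b e q : ℕ}
    (halg : ∀ c : complexBetti (Y ⊗ X) (2 * e), IsRationalClass c →
      IsOfHodgeType (m + n) (Y ⊗ X) (2 * e) e e c → c ∈ algebraicClasses (Y ⊗ X) e)
    (hab : a + 2 * e = b + 2 * n) (hq : b + q = 2 * m) (φ : complexBetti X a →ₗ[ℂ] complexBetti Y b)
    (hφ : ∀ c, IsRationalClass c → IsRationalClass (φ c))
    (hφH : ∀ (p q : ℕ), p + q = a → ∀ c, IsOfHodgeType n X a p q c →
      ∀ (p' q' : ℕ), p' + n = p + e → q' + n = q + e → IsOfHodgeType m Y b p' q' (φ c))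
    (hφ0 : ∀ (p q : ℕ), p + q = a → ∀ c, IsOfHodgeType n X a p q c → (p + e < n ∨ q + e < n) → φ c = 0) :
    IsAlgebraicCorrespondence m n Y X φ := by
  have hI := hodgePQ_independent_of_hodgeModel_holds
  obtain ⟨A⟩ := nonempty_hodgeModel_holds (n := m) (X := Y) hY
  obtain ⟨B⟩ := nonempty_hodgeModel_holds (n := n) (X := X) hX
  let μ : OrientationFamily := fun _ _ h ↦ Classical.choice (Motives.ComplexPoints.isOrientableOver ℂ h)
  obtain ⟨γ, hγr, hγH, t, ht, hact⟩ := exists_hodgeClass_corrAction_eq_smul_of_shift hY hX A B hab φ hφ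
    (fun p q hpq c hc p' q' hp' hq' ↦ (hI.isOfHodgeType_iff hY A).1 (hφH p q hpq c ⟨B, hc⟩ p' q' hp' hq'))
    (fun p q hpq c hc hlt ↦ hφ0 p q hpq c ⟨B, hc⟩ hlt) μ
  have hγalg : γ ∈ algebraicClasses (Y ⊗ X) e := halg γ hγr hγH
  have hφγ : φ = corrAction μ hY hX hab (t⁻¹ • γ) := by
    rw [map_smul, hact, smul_smul, inv_mul_cancel₀ ht, one_smul]
  rw [hφγ]
  exact isAlgebraicCorrespondence_corrAction μ (OrientationFamily.hasPoincareDuality μ) hY hX hab hq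
    (Submodule.smul_mem _ _ hγalg)

end Bridge

/-! ## §2 The fibre-class nodes from `HC^{d}(𝒳 × 𝒳)` — one codimension, the relative dimension -/

variable {𝒳 S : SchemeOver ℂ}

/-- **For each `t`, `L_t = j_{t*} j_t^*` on `H²ᵖ(𝒳)` (`p ≤ d + 1`) has an ALGEBRAIC quasi-inverse as soon as the
rational `(d, d)`-classes of the `(2d+2)`-fold `𝒳 × 𝒳` are algebraic** — the class of the quasi-inverse has
codimension `d` whatever `p` is. No binder. [cite: Voisin2025, Prop. 2.11, Lemma 2.9 and §3.2.2]
[cite: VoisinHodgeI2002, §11.3.3 Lemma 11.41] [cite: Abdulali1994FamiliesAV, Remark 5.4 (p. 1130)] -/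
theorem exists_algebraic_quasiInverse_fiberGysin_of_codim {d : ℕ} {f : 𝒳 ⟶ S} (hf : IsCompactAbelianPencil f d)
    (halg : ∀ c : complexBetti (𝒳 ⊗ 𝒳) (2 * d), IsRationalClass c →
      IsOfHodgeType ((d + 1) + (d + 1)) (𝒳 ⊗ 𝒳) (2 * d) d d c → c ∈ algebraicClasses (𝒳 ⊗ 𝒳) d)
    {p : ℕ} (hp : p ≤ d + 1) (t : ComplexPoints S) :
    ∃ T : complexBetti 𝒳 (2 * (p + 1)) →ₗ[ℂ] complexBetti 𝒳 (2 * p),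
      IsAlgebraicCorrespondence (d + 1) (d + 1) 𝒳 𝒳 T ∧
        ∀ W : complexBetti 𝒳 (2 * p),
          fiberGysin hf t p (complexBetti.map (fiberι f t) (2 * p)
            (T (fiberGysin hf t p (complexBetti.map (fiberι f t) (2 * p) W)))) =
            fiberGysin hf t p (complexBetti.map (fiberι f t) (2 * p) W) := by
  have h𝒳 := hf.isSmoothProjective_total
  set L : complexBetti 𝒳 (2 * p) →ₗ[ℂ] complexBetti 𝒳 (2 * (p + 1)) :=
    fiberGysin hf t p ∘ₗ (complexBetti.map (fiberι f t) (2 * p)).hom with hL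
  have hLapp : ∀ W, L W = fiberGysin hf t p (complexBetti.map (fiberι f t) (2 * p) W) := fun _ ↦ rfl
  obtain ⟨T, hTr, hTH, hT0, hTL⟩ := exists_typeShift_pseudoInverse h𝒳 h𝒳 (r := 1)
    (show 2 * p + 2 * 1 = 2 * (p + 1) by ring) L
    (fun c hc ↦ by rw [hLapp]; exact isRationalClass_fiberGysin_map_fiberι hf t hc)
    (fun p' q' _ c hc ↦ by rw [hLapp]; exact isOfHodgeType_fiberGysin_map_fiberι hf t hc)
  refine ⟨T, ?_, fun W ↦ ?_⟩
  · exact isAlgebraicCorrespondence_of_hodgeClasses_algebraic_prod h𝒳 h𝒳 (e := d) (q := 2 * (d + 1) - 2 * p)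
      halg (by omega) (by omega) T hTr
      (fun p₁ q₁ hpq c hc p₂ q₂ hp₂ hq₂ ↦ hTH p₁ q₁ hpq c hc p₂ q₂ (by omega) (by omega))
      (fun p₁ q₁ hpq c hc hlt ↦ hT0 p₁ q₁ hpq c hc (by omega))
  · have h := hTL W
    simpa only [hLapp] using h

/-- **`κ_f ∧ HC^{d}(𝒳 × 𝒳) ⟹ (β′ᵖᵗ_f)`** (no fibre-class constancy). [cite: Abdulali1994FamiliesAV, Conjecture 5.3 and Remark 5.4 (p. 1130)]
[cite: DeligneHodgeII1971, Thm. 4.1.1 and 4.2.6] -/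
theorem fibreClassLefschetzPointwiseOn_of_codim {d : ℕ} {f : 𝒳 ⟶ S} (hf : IsCompactAbelianPencil f d)
    (hκ : FibreGysinKernelOn hf)
    (halg : ∀ c : complexBetti (𝒳 ⊗ 𝒳) (2 * d), IsRationalClass c →
      IsOfHodgeType ((d + 1) + (d + 1)) (𝒳 ⊗ 𝒳) (2 * d) d d c → c ∈ algebraicClasses (𝒳 ⊗ 𝒳) d) :
    FibreClassLefschetzPointwiseOn hf := by
  intro p hp t
  obtain ⟨T, hT, hTL⟩ := exists_algebraic_quasiInverse_fiberGysin_of_codim hf halg (show p ≤ d + 1 by omega) t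
  refine ⟨T, hT, fun W s ↦ ?_⟩
  rw [← sub_eq_zero, ← map_sub]
  refine hκ p t s _ ?_
  rw [map_sub, map_sub, hTL W, sub_self]

/-- **`φ_f ∧ HC^{d}(𝒳 × 𝒳) ⟹ (A_f)`**. [cite: Abdulali1994FamiliesAV, Conjecture 5.3 and Remark 5.4 (p. 1130)]
[cite: Voisin2025, §3.2.2 Conj. 3.11] -/
theorem algebraicFibreClassQuasiInverseOn_of_codim {d : ℕ} {f : 𝒳 ⟶ S} (hf : IsCompactAbelianPencil f d)
    (hφ : FibreClassConstantOn hf)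
    (halg : ∀ c : complexBetti (𝒳 ⊗ 𝒳) (2 * d), IsRationalClass c →
      IsOfHodgeType ((d + 1) + (d + 1)) (𝒳 ⊗ 𝒳) (2 * d) d d c → c ∈ algebraicClasses (𝒳 ⊗ 𝒳) d) :
    AlgebraicFibreClassQuasiInverseOn hf := by
  intro p hp
  rcases isEmpty_or_nonempty (ComplexPoints S) with hS | ⟨⟨t₀⟩⟩
  · have h𝒳 := hf.isSmoothProjective_total
    obtain ⟨A⟩ := nonempty_hodgeModel_holds h𝒳
    refine ⟨0, ?_, fun t ↦ (IsEmpty.false t).elim⟩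
    exact isAlgebraicCorrespondence_of_hodgeClasses_algebraic_prod h𝒳 h𝒳 (a := 2 * (p + 1)) (b := 2 * p)
      (e := d) (q := 2 * (d + 1) - 2 * p) halg (by omega) (by omega) 0
      (fun _ _ ↦ by rw [LinearMap.zero_apply]; exact IsRationalClass.zero)
      (fun _ _ _ _ _ p₂ q₂ _ _ ↦ by rw [LinearMap.zero_apply]; exact IsOfHodgeType.zero A _ p₂ q₂)
      (fun _ _ _ _ _ _ ↦ rfl)
  · obtain ⟨T, hT, hTL⟩ := exists_algebraic_quasiInverse_fiberGysin_of_codim hf halg (show p ≤ d + 1 by omega) t₀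
    refine ⟨T, hT, fun t W ↦ ?_⟩
    rw [fiberGysin_map_fiberι_eq_of_const hf hφ t t₀ W, fiberGysin_map_fiberι_eq_of_const hf hφ t t₀, hTL W]

/-- **`κ_f ∧ φ_f ∧ HC^{d}(𝒳 × 𝒳) ⟹ (β′_f)`**: part VIII's node needs the Hodge conjecture for `𝒳 × 𝒳` in
codimension `d` only. [cite: Abdulali1994FamiliesAV, Conjecture 5.3 and Remark 5.4 (p. 1130)]
[cite: DeligneHodgeII1971, Thm. 4.1.1 and 4.2.6] -/
theorem fibreClassLefschetzOn_of_codim {d : ℕ} {f : 𝒳 ⟶ S} (hf : IsCompactAbelianPencil f d)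
    (hκ : FibreGysinKernelOn hf) (hφ : FibreClassConstantOn hf)
    (halg : ∀ c : complexBetti (𝒳 ⊗ 𝒳) (2 * d), IsRationalClass c →
      IsOfHodgeType ((d + 1) + (d + 1)) (𝒳 ⊗ 𝒳) (2 * d) d d c → c ∈ algebraicClasses (𝒳 ⊗ 𝒳) d) :
    FibreClassLefschetzOn hf :=
  fibreClassLefschetzOn_of_kernel_of_quasiInverse hf hκ (algebraicFibreClassQuasiInverseOn_of_codim hf hφ halg)

/-- **The graded node (β′)_d from codimension-`d` Hodge classes on the squares of the total spaces** (for the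
W₆ habitat, `d = 6`: the codimension-6 rational Hodge classes of the 14-folds `𝒳 × 𝒳`), modulo κ, φ.
[cite: Abdulali1994FamiliesAV, Conjecture 5.3 (p. 1130)] [cite: Andre1996Motifs, §6.3 Remarque 2 (p. 33)] -/
theorem fibreClassLefschetzOnAtRelDim_of_codim (d : ℕ) (hκ : FibreGysinKernelCompactPencils)
    (hφ : FibreClassConstantCompactPencils)
    (halg : ∀ ⦃𝒳 S : SchemeOver ℂ⦄ ⦃f : 𝒳 ⟶ S⦄, IsCompactAbelianPencil f d →
      ∀ c : complexBetti (𝒳 ⊗ 𝒳) (2 * d), IsRationalClass c →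
        IsOfHodgeType ((d + 1) + (d + 1)) (𝒳 ⊗ 𝒳) (2 * d) d d c → c ∈ algebraicClasses (𝒳 ⊗ 𝒳) d) :
    FibreClassLefschetzOnAtRelDim d :=
  fun _ _ _ hf _ ↦ fibreClassLefschetzOn_of_codim hf (hκ hf) (hφ hf) (halg hf)

/-! ## §3 Relative dimension 1: compact pencils of elliptic curves -/

/-- **(β′ᵖᵗ) for every compact pencil of elliptic curves, modulo Deligne's kernel identity κ_f alone**: the
quasi-inverse classes live in codimension `1` on the fourfold `𝒳 × 𝒳`, where the Hodge conjecture is the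
Lefschetz theorem on `(1,1)`-classes (`lefschetzOneOne_rational_holds`). [cite: VoisinHodgeI2002, §11.3 Thm. 11.30]
[cite: Andre1996Motifs, §6.3 Remarque 2 (p. 33)] -/
theorem fibreClassLefschetzPointwiseOn_of_relDim_one {f : 𝒳 ⟶ S} (hf : IsCompactAbelianPencil f 1)
    (hκ : FibreGysinKernelOn hf) : FibreClassLefschetzPointwiseOn hf :=
  fibreClassLefschetzPointwiseOn_of_codim hf hκ fun c hc hc' ↦
    lefschetzOneOne_rational_holds
      (IsSmoothProjective.tensor_holds hf.isSmoothProjective_total hf.isSmoothProjective_total) c hc hc'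

/-- **(β′_f) for every compact pencil of elliptic curves, modulo κ_f and φ_f** (Lefschetz `(1,1)` on `𝒳 × 𝒳`).
[cite: VoisinHodgeI2002, §11.3 Thm. 11.30] [cite: Andre1996Motifs, §6.3 Remarque 2 (p. 33)] -/
theorem fibreClassLefschetzOn_of_relDim_one {f : 𝒳 ⟶ S} (hf : IsCompactAbelianPencil f 1)
    (hκ : FibreGysinKernelOn hf) (hφ : FibreClassConstantOn hf) : FibreClassLefschetzOn hf :=
  fibreClassLefschetzOn_of_codim hf hκ hφ fun c hc hc' ↦
    lefschetzOneOne_rational_holds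
      (IsSmoothProjective.tensor_holds hf.isSmoothProjective_total hf.isSmoothProjective_total) c hc hc'

/-- **The `d = 1` rung of the graded node (β′)_1, modulo κ, φ** (no Hodge conjecture input).
[cite: VoisinHodgeI2002, §11.3 Thm. 11.30] -/
theorem fibreClassLefschetzOnAtRelDim_one (hκ : FibreGysinKernelCompactPencils)
    (hφ : FibreClassConstantCompactPencils) : FibreClassLefschetzOnAtRelDim 1 :=
  fun _ _ _ hf _ ↦ fibreClassLefschetzOn_of_relDim_one hf (hκ hf) (hφ hf)

end Summit.HodgeConjecture.HodgeConjecture.Ring2.AbelianAll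

end
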